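import Mathlib
import HarnessLib
import HarnessLib.Audit
import Summits.Langlands.Statement
import Literature.NumberTheory.Automorphic.StrongArtinGL2
import Literature.NumberTheory.GaloisRepresentations.ProjectiveType
import Literature.NumberTheory.GaloisRepresentations.ArtinLFunction

/-!
Route: HessianFirstBlood

CLOSED (retired) 2026-08-15T13:48:42Z by operator:999:1257524 — reason: not-a-thesis: assembly does not conclude the sub-problem Statement — note: D-0027 §2.1 audit (human 2026-08-15: routes that do not decide the summit are removed): the assembly concludes `FirstBlood108`, not the sub-problem statement; a NEW conforming route may be opened from the same idea (generated `closes : … → _root_.Langlands`).. The file is kept as the record of this route; refuted decls are indexed as negative knowledge (`ledger negatives`).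

Route HessianFirstBlood — realises idea card Langlands/Langlands/hessian-first-blood-certificate
(SECTOR route, direction (B), n = 3, Artin, primitive SOLVABLE image of "108-type": projective image
3^2:4, the Hessian group H_36).

THESIS X (it suffices to show X). For every irreducible rho : Gamma_Q -> GL_3(C) of 108-type:
(1) CANONICAL DESCENT: there is a cuspidal P on GL_3(A_Q) (JPSS non-normal cubic induction over the
real quadratic field M_1, Arthur–Clozel quadratic descent pinned by omega_P = det rho) whose Satake
class t_p equals rho(Frob_p) at almost every p where Frob_p has projective order 1, 2, 3, and
satisfies t_p^2 ~ rho(Frob_p)^2, det t_p = det rho(Frob_p) where Frob_p has projective order 4 (p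
inert in M_1);
(2) LANDAU SQUEEZE: for such P, if the Artin L-function of Ad rho (given by its character |tr rho|^2
- 1) has no zero on the real segment [1/2, 1], then sum over the disagreement set T of p^{-sigma}
converges for some sigma < 1/2 (Rankin–Selberg |tr|^2-positivity: every wrong candidate at an inert
p has defect +4 at all odd powers, 0 at even powers; Landau's lemma; over Q the factor zeta(sigma) <
0 on (0,1) is harmless, so only L(sigma, Ad rho) = L(sigma, chi_a) L(sigma, chi_b), two cubic Hecke
L-functions of the cyclic quartic field M_2, can carry a real zero);
(3) THIN => AUTOMORPHIC: an irreducible 3-dimensional Artin rho over Q that agrees with a cuspidal P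
off a set of convergence exponent < 1/2 is automorphic (Euler-ratio + Artin FE overlap => all
GL_1-twists entire => Brauer finite order => JPSS/Cogdell–PS GL_3 converse theorem with LLC);
(4) CERTIFIED EXAMPLE: one explicit 108-type rho_0 over Q (candidates inside ray class fields of
Q(zeta_5) of modulus 9, 29 or 31) whose adjoint L-function is certified zero-free on [1/2, 1] by
ball arithmetic.
Then FirstBlood108: some irreducible 108-type rho : Gamma_Q -> GL_3(C) is automorphic (exists
cuspidal pi on GL_3(A_Q) with IsPiOfArtinRep rho pi) — the first primitive-solvable instance of
strong Artin in rank 3, an instance of conjunct (B) GaloisToAutomorphic (n = 3, K = Q) in the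
almost-everywhere (Satake) form; and the conditional theorem ConditionalStrongArtin108 for ALL
108-type rho over Q.

X as one Lean Prop (route decls, Sketch.lean rc = 0): CanonicalDescent108 ∧ LandauSqueeze108 ∧
ThinToAutomorphicGL3 ∧ CertifiedExample108, with Assembly : CanonicalDescent108 → LandauSqueeze108 →
ThinToAutomorphicGL3 → CertifiedExample108 → FirstBlood108, where FirstBlood108 := ∃ ρ :
Literature.NumberTheory.GaloisRepresentations.FramedArtinRep ℚ 3, ρ.toGaloisRep.IsIrreducible ∧
(Nat.card (projectiveImage ρ.toMonoidHom) = 36 ∧ Subgroup.center (projectiveImage ρ.toMonoidHom) = ⊥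
∧ ∃ g, orderOf g = 4) ∧ ∃ hcpt (π : Literature.NumberTheory.Automorphic.CuspidalAutomorphicRepData 3
ℚ hcpt), Literature.NumberTheory.Automorphic.IsPiOfArtinRep ρ π.1.
SECTOR ROUTE: the assembly concludes in the route target FirstBlood108 (an instance family of
conjunct (B) of Summit.Langlands.GlobalLanglandsCorrespondenceGLn), not in `Langlands`; it does not
claim the summit (precedents: CubicRoots → CubicBH, TauberianTwins → PairsHL).

Rationale: WHY THIS LINE. Strong Artin for 3-dimensional rho with primitive solvable image (Hessian types
108/216/648) is open (Lapid1998 Rem. 3 "no other cases seem to be known"; Martin2004;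
Ramakrishnan2002 status list); for 108-type the solvable tower Q < M_1 < M_2 < K ends in a MONOMIAL
group over the real quadratic M_1, so rho|M_1 is genuinely automorphic
(JacquetPiatetskishapiroShalika1979II, non-normal cubic induction) and the only obstruction is the
sign ambiguity of ONE quadratic Arthur–Clozel descent (ArthurClozelAMS120 Ch.3 Thm 4.2(d), 3.1) at
primes inert in M_1. Imported from analytic number theory: Rankin–Selberg positivity + Landau (the
hybrid-comparison architecture of MartinRamakrishnan2016 for n = 2) confines the disagreement set T
below the first real singularity of L^S(P x Pbar)/(zeta_S L_S(Ad rho)); imported from certified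
computation (Booker2006, Platt2017 methodology): for F = Q, zeta has no real zeros on (0,1), so the
only possible real singularities in [1/2,1] are real zeros of two ENTIRE cubic Hecke L-functions of
the cyclic quartic field M_2 — a finite interval-arithmetic certificate per explicit rho. Exponent <
1/2 then makes every GL_1-twist of rho entire (Euler-ratio + Artin FE overlap; Brauer gives finite
order, hence BVS) and the GL_3 converse theorem (JacquetPiatetskishapiroShalika1979 part I;
CogdellPiatetskishapiro1999 n=3) with LLC (HarrisTaylorAMS2001, HenniartInventiones2000) yields
pi(rho).

RANKED CRUXES (typed in Sketch.lean, rc 0; 108-type := projective image of order 36, centreless,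
with an element of order 4 <=> 3^2:4):
#2 LandauSqueeze108 — descent output + no zero of L(s, Ad rho) on [1/2,1] => exists sigma < 1/2 with
sum_T N(v)^{-sigma} < oo. New analytic heart; needs meromorphic continuation/poles of L^S(s, P x
Pbar) (JacquetPiatetskiShapiroShalika1983, MoeglinWaldspurger1989), the defect table (+4 at odd
powers), Landau.
#3 CanonicalDescent108 — existence of the canonical descent P with exact agreement at projective
orders 1,2,3 and squares+det agreement at order 4 (JPSS cubic induction, AC descent, CFT pinning).
Unconditional theorem-level; deep to formalise.
#4 CertifiedExample108 — exists explicit rho_0 (and its adjoint A by character) of 108-type over Q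
with certified zero-free L(sigma, A) on [1/2,1]. Candidates: 3^2:4-extension of Q inside the ray
class field of Q(zeta_5) mod 9 (ramified at 3,5 only; two degree-4 L-functions of conductor 5^3*3^8)
or mod 29/31. Evidence = kit/ARB certificate file; Lean construction of rho_0 is the long pole.
#5 ThinToAutomorphicGL3 — thin agreement (exponent < 1/2, unit Satake parameters) with a cuspidal P
=> automorphic; converse-theorem endgame (standard inputs, none yet in the tree).
Support: ConditionalStrongArtin108 (the theorem of the route: #3+#2+#5), Order36Frobenius (group
theory: the three invariants => V = 3^2 normal, fixed-point-free complement), DefectTable108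
(roots-of-unity table, refuter-verified {1|5,5}).

KILL CRITERIA. (a) A 108-type rho over Q and inert p where the AC descent candidates are not {true,
(g,g,-ug), (-g,-g,-ug)} or a wrong candidate has non-positive odd-power defect — refutes #2's
mechanism (DefectTable108 false). (b) L^S(s, P x Pbar) with a real pole in (0,1) other than from the
listed sources — kills the Landau step. (c) A certified real zero of L(s, chi_a) L(s, chi_b) in
[1/2,1] for EVERY small example would not refute the theorem but starves #4; a proof that
exponent-<1/2 thin agreement does not force automorphy (counterexample pair) refutes #5 and the
line.

DELIBERATELY NOT DECOMPOSED YET. Ramified/archimedean exact matching (not needed in the a.e.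
IsPiOfArtinRep form); the 216-type (3^2:Q_8) rung and the "every Frobenius splits in some quadratic
subfield" exactness lemma (card C4; folklore per MartinRamakrishnan2016 §4); general F with
real-zero-free zeta_F (Watkins2003 covers imaginary quadratic F); local-global compatibility at
ramified places (Corresponds) — all wait for a crux to close.

NOVELTY and BARRIERS: see the dedicated sections (searched before claiming: lit/crossref/galaxy
queries listed there). Technique class: solvable-descent rankin-selberg-positivity landau
certified-computation converse-theorem.

Novelty: NOVELTY (search-before-claim; planner 2026-08-15). Searched: lit read arXiv:1502.04175 =
doi:10.1090/conm/664/13038 (Martin–Ramakrishnan 2016, pp. 2–6 READ: Landau lemma 1.1, Λ =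
L(π×π̄)/L(ρ⊗ρ̄) positivity, Prop. 1.5 finite ⇒ everywhere, converse-theorem endgame, degree trick
Prop. 1.3); crossref "Automorphic forms on GL(3)" (→ JPSS 1979 I/II dois), crossref "Converse
theorems for GLn II" (→ Cogdell–PS 1999), crossref "Artin conjecture primitive three dimensional
representation automorphic" (→ Rogawski 1997 survey doi:10.1090/pspum/061/1476504, paywalled,
acq-02152; Kiming–Wang LNM 1585 = GL(2) numerics), crossref "Hessian group Galois representation
modularity" (→ L. Yang 2018 Hessian polyhedra/Picard modular, unrelated), crossref Watkins real
zeros (→ doi:10.1090/s0025-5718-03-01537-0); galaxy all-corpora "converse theorem for GL(3)" (books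
only: Bump, Cornell–Silverman–Stevens, Coates–Taylor; no automorphy result for Hessian types); plus
the card author's zbMATH/galaxy queries ("Artin conjecture Hessian", "strong Artin conjecture
solvable", Lapid/Martin/Rajan read) and two refuter audits (Ramakrishnan IMRN 2002 pp. 2–4 read:
solvable status list stops at dim 2, monomial, nilpotent). lit search (local/openalex/arxiv/zbmath)
was rate-limited or reset during this session; the crossref/galaxy/held-paper reads above are what
was actually run.
Nearest prior art by id: (1) MartinRamakrishnan2016 (doi:10.1090/conm/664/13038): the SAME Landau +
Rankin–Selberg-positivity + converse-  [refs: 10.1090/conm/664/13038, 10.1090/pspum/061/1476504, 10.1090/s0025-5718-03-01537-0, 10.4171/dm/45, 10.1016/j.crma.2004.05.003, 10.1080/10586458.2006.10128976, 1502.04175, 2512.08307, doi:10.1090/conm/664/13038, doi:10.1090/pspum/061/1476504, doi:10.1090/s0025-5718-03-01537-0, doi:10.4171/dm/45, doi:10.1016/j.crma.2004.05.003, doi:10.1080/10586458.2006.10128976, MartinRamakrishnan2016, Lapid1998, Mar]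

Barriers (technique_class: solvable-descent rankin-selberg certified-computation): Literature.Barriers.Langlands.SolvableImageBarrier: applies in scope (images are soluble) and is
evaded exactly where the barrier's own quote ("cyclic or solvable base change alone does not give
any new cases of the Artin conjecture", ArthurClozelAMS120) leaves room: the route adds two
NON-base-change inputs to the Arthur–Clozel/JPSS tower — Rankin–Selberg |tr|²-positivity with
Landau's lemma (LandauSqueeze108) and a certified real-segment L-value computation
(CertifiedExample108) — and closes with the GL_3 converse theorem (ThinToAutomorphicGL3); no
insoluble layer is claimed, so the Prop (icosahedral images are insoluble) is not engaged.
Literature.Barriers.Langlands.SolvableImageBarrierNarrow: not met — it blocks INSOLUBLE images (A_5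
etc.) along Galois/sub-solvable layers; 108-type images are soluble (3^{1+2}:4 linear), nothing is
claimed for A_5- or PSL_2(7)-type ρ.
Literature.Barriers.Langlands.NonRegularWeightBarrier: evaded by construction — Artin-type
(irregular, weight 0) infinity types are handled by L-functions only (descent, Rankin–Selberg,
converse theorem, numerics); no Betti/coherent cohomology, no p-adic interpolation, no patching, so
the technique class of the barrier (cohomologicalInfinityType) is never entered.
Literature.Barriers.Langlands.ShimuraVarietyRealizationBarrier: not engaged (nothing is realised in
cohomology; the device is field-blind).
Literature.Barriers.Langlands.TwistedEndoscopySelfDual: not engaged (no trace-formula comparison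
beyond cycli

History (route lifecycle, newest last):
- 2026-08-15T13:48:42Z · CLOSED retired — not-a-thesis: assembly does not conclude the sub-problem Statement (operator:999:1257524)

sub-problem: Langlands · status: closed(retired) · opened planner-plancard-Langlands-Langlands-hessian--0cd75f44-0 2026-08-15T11:05:57Z · rev 1 · ledger route-Langlands-HessianFirstBlood
GENERATED by the gate from the ledger (D-0016/17). Provers cite these decls: `theorem foo : Summit.Langlands.Langlands.Theses.HessianFirstBlood.<Decl> := …` in Summits/Langlands/Langlands/Theorems/<Name>.lean.
-/

namespace Summit.Langlands.Langlands.Theses.HessianFirstBlood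

open scoped BigOperators Topology Manifold Classical MeasureTheory ProbabilityTheory Matrix InnerProductSpace ComplexConjugate ContinuousMap
open Filter Set Function TopologicalSpace MeasureTheory

attribute [summit_statement] _root_.Langlands

/-- item stmt-Langlands-2594 · target · rank 0 · closed · moot by None · by planner
why it might fail: Via THIS line only as strong as CertifiedExample108 (a real zero of L(s,chi_a)L(s,chi_b) on [1/2,1] for every small candidate starves it) plus a Lean-built explicit FramedArtinRep Q 3. Caution: target now adjacent to print (arXiv:2512.08307 Thm 17 + Lapid1998 Prop 2, discrete-series condition).
sources: Lapid1998, doi:10.4171/dm/45, arXiv:2512.08307, Martin2004, Ramakrishnan2002, MartinRamakrishnan2016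
[target] FIRST BLOOD IN RANK 3: some irreducible rho : Gamma_Q -> GL_3(C) of 108-type (projective
image the Hessian group 3^2:4 of order 36: centreless, with an element of order 4) is automorphic: a
cuspidal pi on GL_3(A_Q) with IsPiOfArtinRep rho pi (Satake class = rho(Frob_p) at almost all p). An
instance of conjunct (B) GaloisToAutomorphic for n = 3, K = Q in the a.e. form; the first
strong-Artin instance with PRIMITIVE SOLVABLE image in rank >= 3 (open since Langlands-Tunnell:
Lapid1998 Rem. 3, Martin2004, Ramakrishnan2002). Follows from the four cruxes by Assembly. Card:
hessian-first-blood-certificate. -/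
@[route_item "route-Langlands-HessianFirstBlood"]
def FirstBlood108 : Prop :=
  ∃ ρ : Literature.NumberTheory.GaloisRepresentations.FramedArtinRep ℚ 3, ρ.toGaloisRep.IsIrreducible ∧ (Nat.card (Literature.NumberTheory.GaloisRepresentations.projectiveImage ρ.toMonoidHom) = 36 ∧ Subgroup.center (Literature.NumberTheory.GaloisRepresentations.projectiveImage ρ.toMonoidHom) = ⊥ ∧ ∃ g : Literature.NumberTheory.GaloisRepresentations.projectiveImage ρ.toMonoidHom, orderOf g = 4) ∧ ∃ (hcpt : Literature.NumberTheory.Automorphic.isCompact_glFiniteIntegralLevel 3 ℚ) (π : Literature.NumberTheory.Automorphic.CuspidalAutomorphicRepData 3 ℚ hcpt), Literature.NumberTheory.Automorphic.IsPiOfArtinRep ρ π.1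

/-- item stmt-Langlands-2595 · crux · rank 2 · closed · moot by None · by planner
why it might fail: Route's one unrefereed deduction: dies if an order-4 place admits a Satake candidate outside {beta,(g,g,-ug),(-g,-g,-ug)} or with odd-power defect <=0 (positivity of L^S(PxPbar)/zeta^S.L^S(Ad rho) lost), or if that ratio has a real pole on [1/2,1) not from a zero of L(s,Ad rho) (MW89; datum model).
sources: MartinRamakrishnan2016, MoeglinWaldspurger1989, JacquetShalikaAJM1981II, JacquetPiatetskiShapiroShalika1983, MontgomeryVaughan2007, Lapid1998
[crux] LANDAU SQUEEZE (the analytic heart; card N2 made finite). rho 108-type over Q, P cuspidal on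
GL_3(A_Q) with the CanonicalDescent108 property (exact Satake agreement where Frob_p has projective
order 1,2,3; squares + determinant agreement where order 4; unit-modulus parameters), A any 8-dim
Artin rep with character tr A(g) = tr rho(g) tr rho(g^-1) - 1 (= Ad rho), and the Artin L-function
of A admits an entire continuation with no zero on the real segment [1/2,1]. THEN the disagreement
set T = {v : not FrobSatakeCompatibleAt rho P v} has convergence exponent < 1/2: sum_{v in T}
N(v)^{-sigma} < oo for some sigma < 1/2. Proof plan: (i) DefectTable108: at an order-4 place the
candidates are {g,-g,ug} (true), {g,g,-ug}, {-g,-g,-ug} with |power sum|^2 = 1,5,5 at odd powers,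
equal at even powers, so log[L^S(s,P x Pbar)/(zeta_S(s) L_S(s,A))] = 4 sum_{p in T} sum_{k odd}
p^{-ks}/k has NON-NEGATIVE coefficients; (ii) Landau: its abscissa is a real pole of the ratio or
-oo; (iii) real poles in [1/2,oo): L^S(P x Pbar) has poles only at 0,1
(JacquetPiatetskiShapiroShalika1983 + MoeglinWaldspurger1989; at 1 simple against zeta's simple
pole, JacquetShalikaAJM1981II (2.3) in tree), zeta(sig -/
@[route_item "route-Langlands-HessianFirstBlood"]
def LandauSqueeze108 : Prop :=
  ∀ (ρ : Literature.NumberTheory.GaloisRepresentations.FramedArtinRep ℚ 3), ρ.toGaloisRep.IsIrreducible → (Nat.card (Literature.NumberTheory.GaloisRepresentations.projectiveImage ρ.toMonoidHom) = 36 ∧ Subgroup.center (Literature.NumberTheory.GaloisRepresentations.projectiveImage ρ.toMonoidHom) = ⊥ ∧ ∃ g : Literature.NumberTheory.GaloisRepresentations.projectiveImage ρ.toMonoidHom, orderOf g = 4) → ∀ (hcpt : Literature.NumberTheory.Automorphic.isCompact_glFiniteIntegralLevel 3 ℚ) (P : Literature.NumberTheory.Automorphic.CuspidalAutomorphicRepData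 3 ℚ hcpt), (∀ᶠ v : IsDedekindDomain.HeightOneSpectrum (NumberField.RingOfIntegers ℚ) in Filter.cofinite, ∃ α β : Multiset ℂ, P.1.HasSatakeParamAt v α ∧ ρ.IsUnramifiedAt v ∧ ρ.HasFrobCharpolyAt v (Literature.NumberTheory.Automorphic.satakePolynomial β) ∧ (∀ b ∈ β, ‖b‖ = 1) ∧ (∀ a ∈ α, ‖a‖ = 1) ∧ ((β.map (· ^ 2)).toFinset.card ≠ 2 → α = β) ∧ ((β.map (· ^ 2)).toFinset.card = 2 → α.map (· ^ 2) = β.map (· ^ 2) ∧ α.prod = β.prod)) → ∀ A : Literature.NumberTheory.GaloisRepresentations.FramedArtinRep ℚ 8, (∀ g : Field.absoluteGaloisGroup ℚ, Literature.NumberTheory.GaloisRepresentations.FramedRep.trace A g = Literature.NumberTheory.GaloisRepresentations.FramedRep.trace ρ g * Literature.NumberTheory.GaloisRepresentations.FramedRep.trace ρ g⁻¹ - 1) → (∃ L : ℂ → ℂ, Differentiable ℂ L ∧ (∀ s : ℂ, 1 < s.re → L s = Literature.NumberTheory.GaloisRepresentations.artinLFunction A.toArtinRep s) ∧ ∀ σ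 : ℝ, σ ∈ Set.Icc (1 / 2 : ℝ) 1 → L σ ≠ 0) → ∃ σ : ℝ, σ < 1 / 2 ∧ Summable (fun v : {v : IsDedekindDomain.HeightOneSpectrum (NumberField.RingOfIntegers ℚ) // ¬ Literature.NumberTheory.Automorphic.FrobSatakeCompatibleAt ρ P.1 v} => (v.1.residueCard : ℝ) ^ (-σ))

/-- item stmt-Langlands-2597 · crux · rank 4 · closed · moot by None · by planner
why it might fail: Open outcome: each explicit candidate (3^2:4-field in the ray class field of Q(zeta_5) mod 9, 29, 31) may have a real zero of L(s,chi_a)L(s,chi_b) on [1/2,1] (central zero not excluded a priori), forcing the next; ball-arithmetic AFE is routine, the Lean construction of explicit rho_0, A is not.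
sources: Booker2006, Watkins2003, Platt2017, Lapid1998, doi:10.1080/10586458.2006.10128976
[crux] CERTIFIED EXAMPLE (card C1+C2; finite, computational). There exist an explicit irreducible
108-type rho_0 : Gamma_Q -> GL_3(C) and an 8-dim A with tr A = |tr rho_0|^2 - 1 (Ad rho_0 =
Ind_{M_2}^Q chi_a + Ind_{M_2}^Q chi_b, chi_a, chi_b cubic Hecke characters of the cyclic quartic M_2
in the two <t>-orbits; L(sigma, chi) real for real sigma since t^2 inverts chi) such that L(s,A) =
L(s,chi_a) L(s,chi_b) (entire) has NO zero on [1/2,1]. CANDIDATES (CFT by hand, confirm with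
PARI/kit): M_2 = Q(zeta_5), M_1 = Q(sqrt 5); the F_9-isotypic part of Cl_m(M_2)/3 is non-zero for m
= 9 (3 inert; (1+3O)/(1+9O) = F_3[Z/4]; units contribute nothing to the F_9-part since eps is
s^2-fixed), m = 29 (29 = 14 mod 15) and m = 31 (31 = 1 mod 15): K = the 3^2:4-extension inside that
ray class field, rho_0 = Tate lift of Gal(K/Q) = 3^2:4 -> PGL_3(C) (Heisenberg/Weil representation),
ramified at {3,5}, {5,29}, {5,31}; degree-4 conductors 5^3*3^8 (both, m=9), 5^3*29^2 & 5^3*29^4,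
5^3*31^2 & 5^3*31^4. CERTIFICATE: ARB/ball-arithmetic evaluation of Lambda(sigma,chi) on a grid of
[1/2,1] via the smoothed approximate functional equation (root number from Gauss sums, explicit tail
bounds) plus a derivative -/
@[route_item "route-Langlands-HessianFirstBlood"]
def CertifiedExample108 : Prop :=
  ∃ (ρ : Literature.NumberTheory.GaloisRepresentations.FramedArtinRep ℚ 3) (A : Literature.NumberTheory.GaloisRepresentations.FramedArtinRep ℚ 8), ρ.toGaloisRep.IsIrreducible ∧ (Nat.card (Literature.NumberTheory.GaloisRepresentations.projectiveImage ρ.toMonoidHom) = 36 ∧ Subgroup.center (Literature.NumberTheory.GaloisRepresentations.projectiveImage ρ.toMonoidHom) = ⊥ ∧ ∃ g : Literature.NumberTheory.GaloisRepresentations.projectiveImage ρ.toMonoidHom, orderOf g = 4) ∧ (∀ g : Field.absoluteGaloisGroup ℚ, Literature.NumberTheory.GaloisRepresentations.FramedRep.trace A g = Literature.NumberTheory.GaloisRepresentations.FramedRep.trace ρ g * Literature.NumberTheory.GaloisRepresentations.FramedRep.trace ρ g⁻¹ - 1) ∧ ∃ L : ℂ → ℂ, Differentiable ℂ L ∧ (∀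 s : ℂ, 1 < s.re → L s = Literature.NumberTheory.GaloisRepresentations.artinLFunction A.toArtinRep s) ∧ ∀ σ : ℝ, σ ∈ Set.Icc (1 / 2 : ℝ) 1 → L σ ≠ 0

/-- item stmt-Langlands-2596 · support · rank 3 · closed · moot by None · by planner
why it might fail: Rests on JPSS 1979 II non-normal cubic induction + Arthur-Clozel Thm 4.2(d)/3.1 threaded into the RepData model with det-pinning (n=3 odd) and Weil-rep shapes; a.e. form only. Fails as TYPED if the card=2 test misclassified a Frobenius shape (hand check: orders 1,2,3,4 give 1,1,3,2 squares).
sources: Lapid1998, doi:10.4171/dm/45, JacquetPiatetskishapiroShalika1979II, ArthurClozelAMS120, JPSS1981Cubique, Literature.NumberTheory.Automorphic.automorphicInduction_character_cubic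
[crux] CANONICAL DESCENT (card/siblings N5, unconditional). rho : Gamma_Q -> GL_3(C) irreducible of
108-type. Let V = 3^2 < H = 3^2:4 be the normal Sylow-3 of the projective image, M_2 (cyclic
quartic, = fixed field of V), M_1 its real quadratic subfield. Over M_1 the projective image V:2
stabilises a line, so rho|M_1 = Ind from a NON-NORMAL cubic M_1'/M_1 (S_3-closure) of a character:
automorphic P_1 on GL_3(A_{M_1}) by JPSS non-normal cubic automorphic induction
(JacquetPiatetskishapiroShalika1979II), cuspidal, Gal(M_1/Q)-stable; Arthur-Clozel descent
(ArthurClozelAMS120 Ch.3 Thm 4.2(d)) gives P on GL_3(A_Q), two choices differing by the quadratic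
character eta, pinned (n = 3 odd) by omega_P = det rho via CFT. CLAIM as typed: exists hcpt, P
cuspidal such that for almost all v there are alpha (Satake of P) and beta (eigenvalues of
rho(Frob_v), all of norm 1, alpha too) with: alpha = beta unless (beta^2).toFinset has exactly 2
elements (<=> Frob_v of projective order 4 <=> v inert in M_1, where BC only gives t_v^2 ~
rho(Frob_v)^2), in which case alpha^2 = beta^2 as multisets and prod alpha = prod beta. Shapes:
order 1 scalar, order 3 gamma(1,w,w^2) (3 distinct squares), order 2 gam -/
@[route_item "route-Langlands-HessianFirstBlood"]
def CanonicalDescent108 : Prop :=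
  ∀ (ρ : Literature.NumberTheory.GaloisRepresentations.FramedArtinRep ℚ 3), ρ.toGaloisRep.IsIrreducible → (Nat.card (Literature.NumberTheory.GaloisRepresentations.projectiveImage ρ.toMonoidHom) = 36 ∧ Subgroup.center (Literature.NumberTheory.GaloisRepresentations.projectiveImage ρ.toMonoidHom) = ⊥ ∧ ∃ g : Literature.NumberTheory.GaloisRepresentations.projectiveImage ρ.toMonoidHom, orderOf g = 4) → ∃ (hcpt : Literature.NumberTheory.Automorphic.isCompact_glFiniteIntegralLevel 3 ℚ) (P : Literature.NumberTheory.Automorphic.CuspidalAutomorphicRepData 3 ℚ hcpt), ∀ᶠ v : IsDedekindDomain.HeightOneSpectrum (NumberField.RingOfIntegers ℚ) in Filter.cofinite, ∃ α β : Multiset ℂ, P.1.HasSatakeParamAt v α ∧ ρ.IsUnramifiedAt v ∧ ρ.HasFrobCharpolyAt v (Literature.NumberTheory.Automorphic.satakePolynomial β) ∧ (∀ b ∈ β, ‖b‖ = 1) ∧ (∀ a ∈ α, ‖a‖ = 1) ∧ ((β.map (· ^ 2)).toFinset.card ≠ 2 → α = β) ∧ ((β.map (· ^ 2)).toFinset.card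 = 2 → α.map (· ^ 2) = β.map (· ^ 2) ∧ α.prod = β.prod)

/-- item stmt-Langlands-2598 · support · rank 5 · closed · moot by None · by planner
why it might fail: Converse theorem for GL_3 (JPSS79/CPS99), LLC L- and epsilon-matching, contragredient in the RepData model and the Brauer finite-order => BVS step are all unvendored; a convention slip (arithmetic vs geometric Frobenius) is absorbed by rho <-> rho^vee but must be threaded.
sources: MartinRamakrishnan2016, arXiv:1502.04175, JacquetPiatetskishapiroShalika1979, CogdellPiatetskishapiro1999, HenniartInventiones2000, Deligne1973Constantes
[crux] THIN AGREEMENT => AUTOMORPHY (converse-theorem endgame, any irreducible 3-dim Artin rho over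
Q). If a cuspidal P on GL_3(A_Q) with unit-modulus Satake parameters a.e. agrees with rho
(FrobSatakeCompatibleAt) off a set T with sum_{v in T} N(v)^{-sigma} < oo for some sigma < 1/2, then
rho is automorphic (exists cuspidal pi with IsPiOfArtinRep rho pi). Proof plan
(MartinRamakrishnan2016 pp. 3-6 for n = 2): L^S(s, rho x chi) = L^S(s, P x chi) C_chi(s) with C_chi
= prod_{v in T} of local factor ratios, absolutely convergent and non-vanishing on Re s >=
max(sigma,0) (unit modulus on both sides), so Lambda(rho x chi) is holomorphic on Re s >
max(sigma,0) (L(s, P x chi) entire for cuspidal GL_3, Godement-Jacquet; Artin local factors and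
Gamma factors have poles only on Re s <= 0); the same for rho^vee with the contragredient of P (same
T); Artin FE (Brauer; tree: artin_functional_equation) Lambda(rho x chi, s) = W Lambda(rho^vee x
chi^-1, 1-s) and max(sigma,0) < 1/2 make the two half-planes overlap: Lambda(rho x chi) ENTIRE for
every unitary Hecke character chi; Brauer => ratio of order-1 entire functions => finite order =>
bounded in vertical strips; GL_3 converse theorem with GL_1 -/
@[route_item "route-Langlands-HessianFirstBlood"]
def ThinToAutomorphicGL3 : Prop :=
  ∀ (ρ : Literature.NumberTheory.GaloisRepresentations.FramedArtinRep ℚ 3), ρ.toGaloisRep.IsIrreducible → (∃ (hcpt : Literature.NumberTheory.Automorphic.isCompact_glFiniteIntegralLevel 3 ℚ) (P : Literature.NumberTheory.Automorphic.CuspidalAutomorphicRepData 3 ℚ hcpt) (σ : ℝ), σ < 1 / 2 ∧ (∀ᶠ v : IsDedekindDomain.HeightOneSpectrum (NumberField.RingOfIntegers ℚ) in Filter.cofinite, ∃ α : Multiset ℂ, P.1.HasSatakeParamAt v α ∧ ∀ a ∈ α, ‖a‖ = 1) ∧ Summable (fun v : {v : IsDedekindDomain.HeightOneSpectrum (NumberField.RingOfIntegers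 ℚ) // ¬ Literature.NumberTheory.Automorphic.FrobSatakeCompatibleAt ρ P.1 v} => (v.1.residueCard : ℝ) ^ (-σ))) → ∃ (hcpt : Literature.NumberTheory.Automorphic.isCompact_glFiniteIntegralLevel 3 ℚ) (π : Literature.NumberTheory.Automorphic.CuspidalAutomorphicRepData 3 ℚ hcpt), Literature.NumberTheory.Automorphic.IsPiOfArtinRep ρ π.1

/-- item stmt-Langlands-2599 · support · rank 9 · closed · moot by None · by planner
sources: Lapid1998, MartinRamakrishnan2016
[support] THE CONDITIONAL THEOREM OF THE ROUTE: every irreducible 108-type rho : Gamma_Q -> GL_3(C)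
whose adjoint Artin L-function (given by an 8-dim A with tr A = |tr rho|^2 - 1) has an entire
continuation without zeros on [1/2,1] is automorphic (IsPiOfArtinRep). Immediate from
CanonicalDescent108 + LandauSqueeze108 + ThinToAutomorphicGL3 (the unit-modulus clause of
ThinToAutomorphicGL3's hypothesis is the alpha-clause of the descent, by Filter.Eventually.mono).
GRH-implied hypothesis, certifiable per rho (CertifiedExample108). Recorded as the reusable
statement; the 216-type (3^2:Q_8) rung reduces to it over the three Z/4-subfields plus the
biquadratic splitting lemma (MartinRamakrishnan2016 sec. 4; not filed yet). -/
@[route_item "route-Langlands-HessianFirstBlood"]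
def ConditionalStrongArtin108 : Prop :=
  ∀ (ρ : Literature.NumberTheory.GaloisRepresentations.FramedArtinRep ℚ 3), ρ.toGaloisRep.IsIrreducible → (Nat.card (Literature.NumberTheory.GaloisRepresentations.projectiveImage ρ.toMonoidHom) = 36 ∧ Subgroup.center (Literature.NumberTheory.GaloisRepresentations.projectiveImage ρ.toMonoidHom) = ⊥ ∧ ∃ g : Literature.NumberTheory.GaloisRepresentations.projectiveImage ρ.toMonoidHom, orderOf g = 4) → (∃ A : Literature.NumberTheory.GaloisRepresentations.FramedArtinRep ℚ 8, (∀ g : Field.absoluteGaloisGroup ℚ, Literature.NumberTheory.GaloisRepresentations.FramedRep.trace A g = Literature.NumberTheory.GaloisRepresentations.FramedRep.trace ρ g * Literature.NumberTheory.GaloisRepresentations.FramedRep.trace ρ g⁻¹ - 1) ∧ ∃ L : ℂ → ℂ, Differentiable ℂ L ∧ (∀ s : ℂ, 1 < s.re → L s = Literature.NumberTheory.GaloisRepresentations.artinLFunction A.toArtinRep s) ∧ ∀ σ : ℝ, σ ∈ Set.Icc (1 / 2 : ℝ) 1 → L σ ≠ 0) → ∃ (hcpt : Literature.NumberTheory.Automorphic.isCompact_glFiniteIntegralLevel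 3 ℚ) (π : Literature.NumberTheory.Automorphic.CuspidalAutomorphicRepData 3 ℚ hcpt), Literature.NumberTheory.Automorphic.IsPiOfArtinRep ρ π.1

/-- item stmt-Langlands-2600 · support · rank 9 · closed · moot by None · by planner
sources: Lapid1998
[support] GROUP THEORY behind the typed 108-type predicate: a finite group H of order 36 with
trivial centre and an element of order 4 has a normal subgroup N of order 9 and exponent 3 (N =
F_3^2, the Sylow 3-subgroup), every element outside N has order 2 or 4, and no non-trivial element
of N commutes with an element outside N (H = N : Z/4 Frobenius, = SmallGroup(36,9) = 3^2:4; the only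
other centreless group of order 36 is S_3 x S_3, which has no element of order 4). Used by
CanonicalDescent108/LandauSqueeze108 provers to get the tower Q < M_1 < M_2 < K and the Frobenius
shapes, and by CertifiedExample108 to verify the type of rho_0. Elementary Sylow theory,
Mathlib-level. -/
@[route_item "route-Langlands-HessianFirstBlood"]
def Order36Frobenius : Prop :=
  ∀ (H : Type) [Group H] [Finite H], Nat.card H = 36 → Subgroup.center H = ⊥ → (∃ g : H, orderOf g = 4) → ∃ N : Subgroup H, N.Normal ∧ Nat.card N = 9 ∧ (∀ x ∈ N, x ^ 3 = 1) ∧ (∀ g : H, g ∉ N → orderOf g = 2 ∨ orderOf g = 4) ∧ ∀ g : H, g ∉ N → ∀ x ∈ N, g * x = x * g → x = 1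

/-- item stmt-Langlands-2601 · support · rank 9 · closed · moot by None · by planner
sources: Lapid1998, MartinRamakrishnan2016
[support] THE RANKIN-SELBERG DEFECT TABLE AT INERT PLACES (card N1 for 108, refuter-verified
{1|5,5}): for |gamma| = 1, u^2 = -1 and beta = {gamma, -gamma, u gamma} (eigenvalues of rho(Frob_p),
Frob_p of projective order 4 = Weil operator of an order-4 element of SL_2(F_3)), every multiset
alpha != beta with alpha^2 = beta^2 (as multisets) and prod alpha = prod beta is {gamma,gamma,-u
gamma} or {-gamma,-gamma,-u gamma}, and for all k: odd k => |sum alpha_i^k|^2 = |sum beta_i^k|^2 + 4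
(= 5 vs 1); even k => sum alpha_i^k = sum beta_i^k. This is exactly what makes log[L^S(P x
Pbar)/L^S(rho x rhobar)] a Dirichlet series with non-negative coefficients supported on T
(LandauSqueeze108 step (i)). Finite algebra over C; norm_num/ring-level once the three cases are
split. -/
@[route_item "route-Langlands-HessianFirstBlood"]
def DefectTable108 : Prop :=
  ∀ (γ u : ℂ), ‖γ‖ = 1 → u ^ 2 = -1 → ∀ α : Multiset ℂ, α.map (· ^ 2) = ({γ, -γ, u * γ} : Multiset ℂ).map (· ^ 2) → α.prod = ({γ, -γ, u * γ} : Multiset ℂ).prod → α ≠ ({γ, -γ, u * γ} : Multiset ℂ) → ∀ k : ℕ, (Odd k → ‖(α.map (· ^ k)).sum‖ ^ 2 = ‖(({γ, -γ, u * γ} : Multiset ℂ).map (· ^ k)).sum‖ ^ 2 + 4) ∧ (Even k → (α.map (· ^ k)).sum = (({γ, -γ, u * γ} : Multiset ℂ).map (· ^ k)).sum)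

/-- item stmt-Langlands-2602 · assembly · rank 1 · closed · moot by None · by planner
sources: Lapid1998
[assembly] CanonicalDescent108 -> LandauSqueeze108 -> ThinToAutomorphicGL3 -> CertifiedExample108 ->
FirstBlood108: take (rho_0, A) from CertifiedExample108; CanonicalDescent108 gives hcpt, P and the
a.e. descent clause; LandauSqueeze108 (with A and the certificate) gives sigma < 1/2 and summability
over T; the unit-modulus clause needed by ThinToAutomorphicGL3 is the alpha-part of the descent
clause (Filter.Eventually.mono); ThinToAutomorphicGL3 gives pi. SECTOR ROUTE: concludes in the route
target FirstBlood108 (instance of conjunct (B), n = 3 over Q, a.e. form), not in `Langlands`. -/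
@[route_item "route-Langlands-HessianFirstBlood"]
def Assembly : Prop :=
  CanonicalDescent108 → LandauSqueeze108 → ThinToAutomorphicGL3 → CertifiedExample108 → FirstBlood108

end Summit.Langlands.Langlands.Theses.HessianFirstBlood
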